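import Literature.AlgebraicGeometry.Frobenioids.ModelFrobenioidUnits
import Literature.AlgebraicGeometry.Frobenioids.PadicFrobenioidThm12
import Literature.AlgebraicGeometry.Frobenioids.PadicFrobenioidDatumLemmas
import Literature.AlgebraicGeometry.Frobenioids.PadicLocalDiscreteValuation
import HarnessLib

/-!
# Frobenioids II, Thm. 1.2 (i)/(iv): `O^×(A) ≅ O_{K_A}^×` for a `p`-adic Frobenioid (PROOFS)

Mochizuki, *The geometry of Frobenioids II*, Kyushu J. Math. **62** (2008) 401–460, §1, proof of Theorem
1.2 (i), p. 9: "Consideration of the kernel of the homomorphism of group-like monoids on `D`, `B → Φ^gp`,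
reveals that if, moreover, `Λ = ℤ` …, then `C` is of unit-profinite … type" [cite: MochizukiFrdII2008,
Thm 1.2 (i) p.9] — i.e. the unit group `O^×(A)` of an object `A = (A_D, α)` of the `p`-adic Frobenioid
([FrdI] Def. 1.2 (ii): base-identity linear automorphisms) IS the kernel of `B(A_D) → Φ^gp(A_D)`, which
for `B = K^× ×_{Φ₀^gp} Φ^gp` is the unit group `O_{K_A}^×` of the valuation ring of `K_A`.

PROOF-ONLY file (seat abc-iut-L1-d10) over abc-iut-L2-t9's `ModelFrobenioidUnits.lean` (`units`,
`unitsToRatFn`), my `PadicFrobenioidDatumLemmas` / `PadicLocalDiscreteValuation` and t4's datum: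
* `MonGp.map_injective`: groupification preserves injectivity into a cancellative monoid;
* `ker_divZeroHom_eq_unitSubgroup`: for `K` finite over `ℚ_p` (so `ord(O_K^⊳)` is monoprime,
  `isMonoprime_ordInt`, and `ord(O_K^⊳) → ord(O_K^⊳)^rlf` is injective, t2's `Realification.of_injective`),
  the kernel of `Div₀ : K^× → Φ₀^gp(Spec K)` is exactly `O_K^×`;
* `Datum.exists_unitsHom` (the shape abc-iut-L1-d8's Thm. 1.2 (iv) assembly consumes: an INJECTIVE
  `θ : O^×(A) →* K_A^×` with values of valuation `1`, hitting all of `O_{K_A}^×`) and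
  `Datum.nonempty_unitsSubgroup_mulEquiv_unitSubgroup`: `O^×(A) ≃* O_{K_A}^×`, via
  `α ↦ u_α ↦ u_α|_{K^×}`: injective by t9's `unitsToRatFn_injective` + the cartesian square, surjective by
  `Datum.exists_B_over_unit`;
* `AdmitsTfgProfiniteTopology.of_mulEquiv` (transport of t2's Def. 2.8 (i) predicate along `≃*`) and
  `Datum.thm12_i_unitProfinite_of`: hence [FrdII] Thm. 1.2 (i), first sentence ("`C` is of unit-profinite
  type", t4's `Thm12_i_unitProfinite`) follows from the local-field fact that each `O_{K_A}^×` admits a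
  topologically finitely generated profinite topology (hypothesis; not proved here).
No definitions; nothing here bears on [IUTchIII].
-/

namespace Literature.AlgebraicGeometry.Frobenioids

open CategoryTheory Opposite Function ValuativeRel

universe v u

/-! ### Groupification preserves injectivity into cancellative monoids -/

/-- If `f : M → N` is an injective homomorphism into a cancellative commutative monoid, then
`f^gp : M^gp → N^gp` is injective. [cite: MochizukiFrdI2008, §0 p.11] -/
theorem MonGp.map_injective {M N : Type u} [CommMonoid M] [CommMonoid N] [IsCancelMul N] (f : M →* N)
    (hf : Injective f) : Injective (MonGp.map f) := by
  rw [injective_iff_map_eq_one]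
  intro z hz
  obtain ⟨a, b, hab⟩ := grothendieckGroup_exists_mul_of_eq_of z
  have h := congrArg (MonGp.map f) hab
  rw [map_mul, hz, one_mul, MonGp.map_of, MonGp.map_of] at h
  have hba : b = a := hf (Algebra.GrothendieckGroup.of_injective h)
  rw [hba] at hab
  exact mul_right_cancel (hab.trans (one_mul _).symm)

/-! ### Monoprime monoids are cancellative and sharp -/

section Monoprime

variable {M : Type u} [CommMonoid M]

/-- A monoid isomorphic to `ℤ_{≥0}`, `ℚ_{≥0}` or `ℝ_{≥0}` is cancellative. [cite: MochizukiFrdI2008, §0 p.10] -/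
private theorem isCancelMul_of_equiv {L : Type*} [AddCommMonoid L] [IsCancelAdd L]
    (e : M ≃* Multiplicative L) : IsCancelMul M where
  mul_left_cancel a b c h := by
    dsimp only at h
    exact e.injective (mul_left_cancel (a := e a) (by rw [← map_mul, ← map_mul, h]))
  mul_right_cancel a b c h := by
    dsimp only at h
    exact e.injective (mul_right_cancel (b := e a) (by rw [← map_mul, ← map_mul, h]))

/-- A monoid isomorphic to `ℤ_{≥0}`, `ℚ_{≥0}` or `ℝ_{≥0}` is sharp (no units but `1`).
[cite: MochizukiFrdI2008, §0 p.10] -/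
private theorem isSharp_of_equiv {L : Type*} [AddCommMonoid L] [PartialOrder L] [CanonicallyOrderedAdd L]
    (e : M ≃* Multiplicative L) : IsSharp M := by
  refine ⟨fun a ha => ?_⟩
  obtain ⟨u, rfl⟩ := ha
  have h : Multiplicative.toAdd (e (u : M)) + Multiplicative.toAdd (e ((u⁻¹ : Mˣ) : M)) = 0 := by
    rw [← toAdd_mul, ← map_mul, Units.mul_inv, map_one, toAdd_one]
  have h1 : e (u : M) = 1 := Multiplicative.toAdd.injective (by rw [(add_eq_zero.mp h).1, toAdd_one])
  exact e.injective (h1.trans (map_one e).symm)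

/-- A monoprime monoid ([FrdI] §0) is cancellative. [cite: MochizukiFrdI2008, §0 p.10] -/
theorem IsMonoprime.isCancelMul (hM : IsMonoprime M) : IsCancelMul M := by
  rcases hM with ⟨⟨⟨e⟩⟩⟩ | ⟨⟨⟨e⟩⟩⟩ | ⟨⟨⟨e⟩⟩⟩
  · exact isCancelMul_of_equiv e
  · exact isCancelMul_of_equiv e
  · exact isCancelMul_of_equiv e

/-- A monoprime monoid ([FrdI] §0) is sharp. [cite: MochizukiFrdI2008, §0 p.10] -/
theorem IsMonoprime.isSharp (hM : IsMonoprime M) : IsSharp M := by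
  rcases hM with ⟨⟨⟨e⟩⟩⟩ | ⟨⟨⟨e⟩⟩⟩ | ⟨⟨⟨e⟩⟩⟩
  · exact isSharp_of_equiv e
  · exact isSharp_of_equiv e
  · exact isSharp_of_equiv e

end Monoprime

namespace PadicFrd

/-! ### The kernel of `Div₀ : K^× → Φ₀^gp` is `O_K^×` for a `p`-adic local field -/

/-- For `K` finite over `ℚ_p` with its `p`-adic valuation, `Ker(K^× → (ord(O_K^⊳) ⊗ ℝ_{≥0})^gp) = O_K^×`:
`ord(O_K^⊳)` is monoprime, so it embeds in its realification, and groupification preserves the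
embedding. [cite: MochizukiFrdII2008, Thm 1.2 (i) p.9] -/
theorem ker_divZeroHom_eq_unitSubgroup {p : ℕ} [Fact p.Prime] {K : Type u} [Field K] [ValuativeRel K]
    [Algebra ℚ_[p] K] [Module.Finite ℚ_[p] K]
    (hc : ∀ a b : ℚ_[p], algebraMap ℚ_[p] K a ≤ᵥ algebraMap ℚ_[p] K b ↔ a ≤ᵥ b) :
    (divZeroHom K).ker = unitSubgroup K := by
  haveI := isCancelMul_realification (OrdInt K)
  have hinj : Injective (MonGp.map (Realification.of (OrdInt K))) :=
    MonGp.map_injective _ (Realification.of_injective (isMonoprime_ordInt hc))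
  ext x
  rw [← ker_divUnits, MonoidHom.mem_ker, MonoidHom.mem_ker, divZeroHom, MonoidHom.comp_apply,
    ← map_one (MonGp.map (Realification.of (OrdInt K))), hinj.eq_iff]

namespace Datum

variable {D : Type u} [Category.{v} D] {p : ℕ} [Fact p.Prime] (d : Datum D p)

/-- `O^×(X)` of found's Def. 1.2 (ii) for the structure functor of the `p`-adic Frobenioid is t9's `units X`
(same carrier, definitionally). [cite: MochizukiFrdI2008, Def. 1.2(ii)] -/
theorem unitsSubgroup_eq_units (X : d.frobenioid) :
    PreFrobenioid.unitsSubgroup d.structureFunctor X = ModelFrobenioid.units X :=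
  SetLike.ext fun _ => Iff.rfl

/-- The restriction to `K_A^×` of the rational function `u_α` of a unit `α ∈ O^×(A)` is a UNIT of the valuation
ring: `u_α ∈ Ker(Div_B)` (the divisor of an automorphism vanishes, `Φ(A_D)` being monoprime hence sharp),
so `u_α|_{K^×} ∈ Ker(Div₀) = O_K^×`. [cite: MochizukiFrdII2008, Thm 1.2 (i) p.9] -/
theorem toB0_unit_mem_unitSubgroup (X : d.frobenioid) (α : ModelFrobenioid.units X) :
    (show (d.fld X.base)ˣ from (d.toB0.app (op X.base)).hom (ModelFrobenioid.unit α.1.hom)) ∈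
      unitSubgroup (d.fld X.base) := by
  obtain ⟨⟨inst, hfin, hc⟩⟩ := d.isPadicLocal X.base
  letI := inst
  haveI := hfin
  have hsharp : IsSharp (d.Φ.obj (op X.base)) := (d.isMonoprime (op X.base)).isSharp
  have hdiv : Frobenioids.divB d.Φ d.B d.divB (op X.base) (ModelFrobenioid.unit α.1.hom) = 1 := by
    have h := ModelFrobenioid.divB_unitsToRatFn_eq_one hsharp α
    rwa [ModelFrobenioid.coe_unitsToRatFn] at h
  rw [← ker_divZeroHom_eq_unitSubgroup hc, MonoidHom.mem_ker]
  have hsq := d.square_apply (op X.base) (ModelFrobenioid.unit α.1.hom)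
  rw [hdiv, map_one] at hsq
  exact hsq

/-- **`O^×(A) ↪ K_A^×` with image `O_{K_A}^×`** for every object `A = (A_D, α)` of the `p`-adic
Frobenioid ("consideration of the kernel of … `B → Φ^gp`", FrdII p. 9): there is an INJECTIVE group
homomorphism `θ : O^×(A) → K_A^×`, `α ↦ u_α|_{K^×}` (found's `unitsSubgroup` of the structure functor),
whose values are units of the valuation ring (`v(θ α) = 1`) and which hits every such unit — the shape
requested by abc-iut-L1-d8 for Thm. 1.2 (iv). [cite: MochizukiFrdII2008, Thm 1.2 (i) p.9] -/
theorem exists_unitsHom (X : d.frobenioid) :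
    ∃ θ : PreFrobenioid.unitsSubgroup d.structureFunctor X →* (d.fld X.base)ˣ,
      Injective θ ∧ (∀ v, valuation (d.fld X.base) ((θ v : (d.fld X.base)ˣ) : d.fld X.base) = 1) ∧
        ∀ x : (d.fld X.base)ˣ, x ∈ unitSubgroup (d.fld X.base) → ∃ v, θ v = x := by
  let e : PreFrobenioid.unitsSubgroup d.structureFunctor X ≃* ModelFrobenioid.units X :=
    MulEquiv.subgroupCongr (d.unitsSubgroup_eq_units X)
  -- the homomorphism `α ↦ u_α|_{K^×}` on t9's `units X`
  let f : ModelFrobenioid.units X →* (d.fld X.base)ˣ :=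
    ((d.toB0.app (op X.base)).hom).comp ((Units.coeHom _).comp (ModelFrobenioid.unitsToRatFn X))
  have hf : ∀ α, f α = (d.toB0.app (op X.base)).hom (ModelFrobenioid.unit α.1.hom) := fun α => rfl
  refine ⟨f.comp e.toMonoidHom, ?_, ?_, ?_⟩
  · -- injective: `α` is determined by `u_α` (t9), and `u_α` by `(u_α|_{K^×}, Div_B u_α = 0)` (cartesian)
    suffices hfinj : Injective f from hfinj.comp e.injective
    intro α β h
    rw [hf, hf] at h
    haveI := (d.isMonoprime (op X.base)).isCancelMul
    have hint : IsIntegral (d.Φ.obj (op X.base)) := ⟨Algebra.GrothendieckGroup.of_injective⟩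
    have hsharp : IsSharp (d.Φ.obj (op X.base)) := (d.isMonoprime (op X.base)).isSharp
    apply ModelFrobenioid.unitsToRatFn_injective hint
    apply Units.ext
    rw [ModelFrobenioid.coe_unitsToRatFn, ModelFrobenioid.coe_unitsToRatFn]
    refine d.B_ext (op X.base) h ?_
    have ha := ModelFrobenioid.divB_unitsToRatFn_eq_one hsharp α
    have hb := ModelFrobenioid.divB_unitsToRatFn_eq_one hsharp β
    rw [ModelFrobenioid.coe_unitsToRatFn] at ha hb
    rw [ha, hb]
  · -- values are units of `O_K`
    intro v
    rw [← mem_unitSubgroup_iff]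
    exact d.toB0_unit_mem_unitSubgroup X (e v)
  · -- every unit `x` of `O_K` lifts to `u ∈ B(A_D)` over `(x, 0)`, giving the unit `(1, id, 0, u)` of `A`
    intro x hx
    obtain ⟨u, hu₁, hu₂⟩ := d.exists_B_over_unit (op X.base) x hx
    obtain ⟨w, rfl⟩ := d.isUnit_B (op X.base) u
    have hrel : ∀ v : (d.B.obj (op X.base))ˣ, Frobenioids.divB d.Φ d.B d.divB (op X.base) v = 1 →
        X.cls ^ ((1 : ℕ+) : ℕ) * Algebra.GrothendieckGroup.of (1 : d.Φ.obj (op X.base)) =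
          pullGp d.Φ (𝟙 X.base) X.cls * Frobenioids.divB d.Φ d.B d.divB (op X.base) v := fun v hv => by
      rw [PNat.one_coe, pow_one, map_one, mul_one, hv, mul_one, pullGp_id]
    have hw' : Frobenioids.divB d.Φ d.B d.divB (op X.base) ((w⁻¹ : (d.B.obj (op X.base))ˣ) : _) = 1 := by
      have h : Frobenioids.divB d.Φ d.B d.divB (op X.base) ((w⁻¹ : (d.B.obj (op X.base))ˣ) : _) =
          (Frobenioids.divB d.Φ d.B d.divB (op X.base) (w : _))⁻¹ :=
        eq_inv_of_mul_eq_one_right (by rw [← map_mul, Units.mul_inv, map_one])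
      rw [h, hu₂, inv_one]
    let α : X ≅ X :=
      { hom := ⟨1, 𝟙 X.base, 1, w, hrel w hu₂⟩
        inv := ⟨1, 𝟙 X.base, 1, ((w⁻¹ : (d.B.obj (op X.base))ˣ) : _), hrel _ hw'⟩
        hom_inv_id := by
          apply ModelFrobenioid.hom_ext
          · rfl
          · exact Category.id_comp _
          · change (d.Φ.map (𝟙 X.base).op).hom 1 * 1 ^ ((1 : ℕ+) : ℕ) = 1
            rw [map_one, one_pow, mul_one]
          · change (d.B.map (𝟙 X.base).op).hom ((w⁻¹ : (d.B.obj (op X.base))ˣ) : _) *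
                (w : d.B.obj (op X.base)) ^ ((1 : ℕ+) : ℕ) = 1
            rw [op_id, d.B.map_id, CommMonCat.hom_id, MonoidHom.id_apply, PNat.one_coe, pow_one,
              Units.inv_mul]
        inv_hom_id := by
          apply ModelFrobenioid.hom_ext
          · rfl
          · exact Category.id_comp _
          · change (d.Φ.map (𝟙 X.base).op).hom 1 * 1 ^ ((1 : ℕ+) : ℕ) = 1
            rw [map_one, one_pow, mul_one]
          · change (d.B.map (𝟙 X.base).op).hom (w : d.B.obj (op X.base)) *
                ((w⁻¹ : (d.B.obj (op X.base))ˣ) : _) ^ ((1 : ℕ+) : ℕ) = 1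
            rw [op_id, d.B.map_id, CommMonCat.hom_id, MonoidHom.id_apply, PNat.one_coe, pow_one,
              Units.mul_inv] }
    have hα : α ∈ ModelFrobenioid.units X := ⟨rfl, rfl⟩
    refine ⟨e.symm ⟨α, hα⟩, ?_⟩
    change f (e (e.symm ⟨α, hα⟩)) = x
    rw [e.apply_symm_apply, hf]
    exact hu₁

/-- **`O^×(A) ≅ O_{K_A}^×`** (group isomorphism, as `Nonempty`) for every object of the `p`-adic Frobenioid:
the unit group of [FrdI] Def. 1.2 (ii) IS the unit group of the valuation ring of the field under the base
object — "the kernel of `B → Φ^gp`" (FrdII p. 9). [cite: MochizukiFrdII2008, Thm 1.2 (i) p.9] -/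
theorem nonempty_unitsSubgroup_mulEquiv_unitSubgroup (X : d.frobenioid) :
    Nonempty (PreFrobenioid.unitsSubgroup d.structureFunctor X ≃* unitSubgroup (d.fld X.base)) := by
  obtain ⟨θ, hinj, hval, hsurj⟩ := d.exists_unitsHom X
  let g : PreFrobenioid.unitsSubgroup d.structureFunctor X →* unitSubgroup (d.fld X.base) :=
    θ.codRestrict _ fun v => (mem_unitSubgroup_iff (d.fld X.base)).mpr (hval v)
  refine ⟨MulEquiv.ofBijective g ⟨fun a b h => hinj (congrArg Subtype.val h), fun x => ?_⟩⟩
  obtain ⟨v, hv⟩ := hsurj x.1 x.2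
  exact ⟨v, Subtype.ext hv⟩

end Datum

/-! ### Transport of "admits a tfg profinite topology" along a group isomorphism -/

/-- "Admits a topologically finitely generated profinite topology" ([FrdI] Def. 2.8 (i), abc-iut-L1-t2's
`AdmitsTfgProfiniteTopology`) is invariant under group isomorphisms (pull the topology back along `e`).
[cite: MochizukiFrdI2008, Def. 2.8(i) p.52] -/
theorem AdmitsTfgProfiniteTopology.of_mulEquiv {M N : Type*} [Group M] [Group N] (e : M ≃* N)
    (h : AdmitsTfgProfiniteTopology N) : AdmitsTfgProfiniteTopology M := by
  classical
  obtain ⟨t, ht⟩ := h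
  letI : TopologicalSpace N := t
  letI : TopologicalSpace M := TopologicalSpace.induced e t
  haveI := ht.isTopologicalGroup
  haveI := ht.compactSpace
  haveI := ht.t2Space
  haveI := ht.totallyDisconnectedSpace
  have hind : Topology.IsInducing e := ⟨rfl⟩
  let eh : M ≃ₜ N :=
    { e.toEquiv with
      continuous_toFun := continuous_induced_dom
      continuous_invFun := by
        refine continuous_induced_rng.2 ?_
        have hc : ((e : M → N) ∘ e.invFun) = id := funext fun x => e.apply_symm_apply x
        rw [hc]
        exact continuous_id }
  refine ⟨TopologicalSpace.induced e t, hind.topologicalGroup e, eh.symm.compactSpace, eh.symm.t2Space,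
    eh.symm.totallyDisconnectedSpace, ?_⟩
  obtain ⟨S, hS⟩ := ht.exists_finset_dense
  refine ⟨S.image e.symm, ?_⟩
  have hset : (Subgroup.closure ((S.image e.symm : Finset M) : Set M) : Set M) =
      eh ⁻¹' (Subgroup.closure (S : Set N) : Set N) := by
    ext x
    rw [Finset.coe_image, ← MulEquiv.coe_toMonoidHom, ← MonoidHom.map_closure, SetLike.mem_coe,
      Subgroup.mem_map_equiv, MulEquiv.symm_symm]
    rfl
  rw [hset, dense_iff_closure_eq, ← eh.preimage_closure, dense_iff_closure_eq.mp hS, Set.preimage_univ]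

namespace Datum

variable {D : Type u} [Category.{v} D] {p : ℕ} [Fact p.Prime] (d : Datum D p)

/-- **Thm. 1.2 (i), first sentence, reduced to the local-field fact**: if each `O_{K_A}^×` (units of the
valuation ring of the finite extension `K_A` of `ℚ_p`) admits a topologically finitely generated profinite
topology, then the `p`-adic Frobenioid "is of unit-profinite type" (abc-iut-L1-t4's `Thm12_i_unitProfinite`),
by transport along `O^×(A) ≅ O_{K_A}^×`. [cite: MochizukiFrdII2008, Thm 1.2 (i) p.9] -/
theorem thm12_i_unitProfinite_of
    (h : ∀ A : D, AdmitsTfgProfiniteTopology (unitSubgroup (d.fld A))) : Thm12_i_unitProfinite d := by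
  intro X
  obtain ⟨e⟩ := d.nonempty_unitsSubgroup_mulEquiv_unitSubgroup X
  exact AdmitsTfgProfiniteTopology.of_mulEquiv e (h X.base)

end Datum

end PadicFrd

end Literature.AlgebraicGeometry.Frobenioids
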